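import Mathlib

/-!
# Kink budget: the KKT sign law of a minimax (power-mean) relay optimum,
# and the envelope theorem's second-order design slack on the Reynolds ladder

Copyright: pub-fluidc cell (idea-1 lens, gen 13). HONEST FRAMING: low prior, high value-of-information
experiment on Tao's machine paradigm; NOT a claim that NS blows up.

Cell `pub-fluidc` (FLUID COMPUTER; host summit `NavierStokesRegularity`, negation side, machine
paradigm), idea-1 seat gen 13 (variational / optimal-gadget lens). Pre-registration
`HOME/pub-fluidc-idea-1/PREREG-R2.md` §10ar (P-G13-1, the ENVELOPE THEOREM of the level-one design
problem) and §10as (P-G13-2, ROW (d) IS A MINIMAX KINK); atlas `HOME/atlas/IDEA-1.md` §17.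
HONEST FRAMING: low prior, high value-of-information experiment on Tao's machine paradigm; NOT a claim
that NS blows up. Nothing here is about the Navier–Stokes equations: these are elementary facts about
real numbers (and one line of one-variable calculus) over the cell's dictionary.

Dictionary (cell units, RULINGS R33 (iii) / R40 (A) / R44). The relay objective of opt-adj's pass-1
row (d) is the power mean of order `-q` (`q = 12`) of the two SMOOTH limbs `f₁ = r1_smooth`,
`f₂ = r2_smooth`: `J = ((f₁^(-q) + f₂^(-q))/2)^(-1/q)`. Its partial derivatives are the power-mean
WEIGHTS `wᵢ = ∂J/∂fᵢ = ½ (J/fᵢ)^(q+1)` (`pmWeight`). At a stationary point of `J` on the design manifold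
the tangential KKT condition reads `w₁·d₁ + w₂·d₂ = 0` for the directional derivatives `dᵢ` of the limbs
along ANY admissible displacement; in logarithmic units `ℓᵢ = dᵢ/fᵢ` this is `ℓ₂ = -κ·ℓ₁` with the
MARGINAL RATE `κ = (w₁ f₁)/(w₂ f₂) = (f₂/f₁)^q` (`kappa_pm`). The two-octave budget of ASK A-G11-1 in the
same currency is `Q_s = λ² f₁ f₂`, so `d ln Q_s = ℓ₁ + ℓ₂ = (1 - κ)·ℓ₁`.

* `kkt_logRate` — the KKT condition in log units: `ℓ₂ = -κ ℓ₁`;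
* `dlogBudget_eq` — `ℓ₁ + ℓ₂ = (1 - κ) ℓ₁`;
* `budget_gain_spends_smaller_limb` — THE SIGN LAW (P-G13-2 (a)): if `1 < κ` (the level-one limb is the
  smaller one in the objective's currency, `f₁ < f₂`, see `one_lt_kappa_pm`) then every first-order
  budget gain LOWERS level one and RAISES level two: `0 < ℓ₁ + ℓ₂ → ℓ₁ < 0 ∧ 0 < ℓ₂`;
* `level_one_gain_lowers_budget` — conversely a displacement that re-tunes level one (`0 < ℓ₁`) loses
  budget to first order; `budget_stationary_of_balanced` — at an exactly balanced kink (`κ = 1`) the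
  budget is stationary too;
* `pmWeight_lt_of_lt`, `one_lt_kappa_pm` — for the power mean of negative order the SMALLER limb carries
  the LARGER weight, and `κ = (f₂/f₁)^q > 1` iff `f₁ < f₂`;
* numeric anchors at row (d) (`norm_num`): `rowD_limbs` (`f₂/f₁ - 1 ∈ (0.0251, 0.0252)`: limbs equal to
  2.5 %), `rowD_kappa` (`κ = (0.57195/0.55794)^12 ∈ (1.346, 1.347)`), `rowD_weightRatio`
  (`w₁/w₂ = (f₂/f₁)^13 ∈ (1.380, 1.381)`), `rowD_budgetRate` (`d ln Q_s/d ln f₁ = 1 - κ ∈ (-0.347, -0.346)`),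
  `rowD_Qs` (`Q_s = 4 f₁ f₂ ∈ (1.2764, 1.2765)`);
* `slack_isLocalMin`, `slack_deriv_eq_zero` — THE ENVELOPE THEOREM's first-order content (P-G13-1): if
  `W ν ≤ V ν` for all `ν` (a frozen design never beats the value function) with equality at `ν₀` (the
  design is optimal there), the design slack `V - W` has a local minimum at `ν₀`, hence zero derivative
  there whatever the differentiability (Mathlib's `deriv` convention) — re-optimisation recovers only
  SECOND-ORDER slack;
* `slackModel`, `slackModel_two_thirds`, `envelopeGrowth_window` — the lens's quadratic slack model on
  the ladder coordinate `x = (ν₀ - ν)/ν₀` calibrated by the Euler end (`x = 1`, A6 growth `1 + S_E`,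
  `S_E = 0.1003`) and the residual slack `s₀ ∈ [0, 0.06]` at `ν₀`: at `ν₀/3` (`x = 2/3`) the predicted
  stage-1 growth `1 + s₀ + (4/9)(S_E - s₀)` lies in `[1.044, 1.078] ⊂ [1.035, 1.085]` (P-G13-1 (b)) and
  never exceeds the Euler calibration `1 + S_E` (P-G13-1 (a)) as long as `s₀ ≤ S_E`.

Provenance: statements and proofs by idea-1 gen 13 (`HOME/pub-fluidc-idea-1/lean/KinkBudget.lean`,
sha16 177b0d6aacc7db45, LEAN ASK #11, cell STATUS l.4499 / `atlas/IDEA-1.md` §17 GEN-13 SUPPLEMENT); filed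
through the gate by pub-fluidc-lit gen 43 with this header paragraph and eight one-line docstrings
(`pmWeight_def`, `kappaPM_def`, `pmWeight_pos`, `kappa_pm_eq_one_of_eq`, `slackModel_zero`, `slackModel_one`,
`envelopeGrowth_mono_s₀`, `envelopeGrowth_in_registered_window`; lint.docstring) added; no statement or proof
was changed.
-/

namespace Summit.NavierStokesRegularity.FluidComputer.KinkBudget

open Real Filter

/-! ## Power-mean weights and the marginal rate -/

/-- Power-mean weight `wᵢ = ∂J/∂fᵢ = ½ (J/f)^(q+1)` of a limb `f` in the power mean `J` of order `-q`. -/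
noncomputable def pmWeight (q : ℕ) (f J : ℝ) : ℝ := (1 / 2) * (J / f) ^ (q + 1)

/-- Marginal rate `κ = (f₂/f₁)^q` of the power mean of order `-q`: `d ln f₂ = -κ · d ln f₁` at a kink. -/
noncomputable def kappaPM (q : ℕ) (f₁ f₂ : ℝ) : ℝ := (f₂ / f₁) ^ q

/-- Unfolding of `pmWeight`. -/
theorem pmWeight_def (q : ℕ) (f J : ℝ) : pmWeight q f J = (1 / 2) * (J / f) ^ (q + 1) := rfl
/-- Unfolding of `kappaPM`. -/
theorem kappaPM_def (q : ℕ) (f₁ f₂ : ℝ) : kappaPM q f₁ f₂ = (f₂ / f₁) ^ q := rfl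

/-- Power-mean weights of positive limbs in a positive mean are positive. -/
theorem pmWeight_pos (q : ℕ) {f J : ℝ} (hf : 0 < f) (hJ : 0 < J) : 0 < pmWeight q f J := by
  unfold pmWeight; positivity

/-- For a power mean of negative order the SMALLER limb carries the LARGER weight. -/
theorem pmWeight_lt_of_lt (q : ℕ) {f₁ f₂ J : ℝ} (hf₁ : 0 < f₁) (h : f₁ < f₂) (hJ : 0 < J) :
    pmWeight q f₂ J < pmWeight q f₁ J := by
  unfold pmWeight
  have hf₂ : 0 < f₂ := lt_trans hf₁ h
  have hlt : J / f₂ < J / f₁ := div_lt_div_of_pos_left hJ hf₁ h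
  have hnn : 0 ≤ J / f₂ := by positivity
  have hp : (J / f₂) ^ (q + 1) < (J / f₁) ^ (q + 1) :=
    pow_lt_pow_left₀ hlt hnn (Nat.succ_ne_zero q)
  linarith

/-- The weight ratio is a pure power of the limb ratio: `w₁/w₂ = (f₂/f₁)^(q+1)`. -/
theorem pmWeight_ratio (q : ℕ) {f₁ f₂ J : ℝ} (hf₁ : 0 < f₁) (hf₂ : 0 < f₂) (hJ : 0 < J) :
    pmWeight q f₁ J / pmWeight q f₂ J = (f₂ / f₁) ^ (q + 1) := by
  unfold pmWeight
  have h1 : (J / f₁) ^ (q + 1) = J ^ (q + 1) / f₁ ^ (q + 1) := div_pow J f₁ (q + 1)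
  have h2 : (J / f₂) ^ (q + 1) = J ^ (q + 1) / f₂ ^ (q + 1) := div_pow J f₂ (q + 1)
  rw [h1, h2, div_pow]
  have hJp : 0 < J ^ (q + 1) := by positivity
  have hf1p : 0 < f₁ ^ (q + 1) := by positivity
  have hf2p : 0 < f₂ ^ (q + 1) := by positivity
  field_simp

/-- The marginal rate in weights: `(w₁ f₁)/(w₂ f₂) = (f₂/f₁)^q = κ`. -/
theorem kappa_pm (q : ℕ) {f₁ f₂ J : ℝ} (hf₁ : 0 < f₁) (hf₂ : 0 < f₂) (hJ : 0 < J) :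
    pmWeight q f₁ J * f₁ / (pmWeight q f₂ J * f₂) = kappaPM q f₁ f₂ := by
  unfold pmWeight kappaPM
  rw [div_pow, div_pow, div_pow]
  have hJp : 0 < J ^ (q + 1) := by positivity
  have hf1p : 0 < f₁ ^ (q + 1) := by positivity
  have hf2p : 0 < f₂ ^ (q + 1) := by positivity
  have hf1q : 0 < f₁ ^ q := by positivity
  field_simp
  ring

/-- `κ > 1` iff the level-one limb is the smaller one (for `q ≥ 1`). -/
theorem one_lt_kappa_pm {q : ℕ} (hq : q ≠ 0) {f₁ f₂ : ℝ} (hf₁ : 0 < f₁) (h : f₁ < f₂) :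
    1 < kappaPM q f₁ f₂ := by
  unfold kappaPM
  have hr : 1 < f₂ / f₁ := (one_lt_div hf₁).mpr h
  exact one_lt_pow₀ hr hq

/-- At an exactly balanced kink (`f₁ = f₂`) the marginal rate is `κ = 1`. -/
theorem kappa_pm_eq_one_of_eq (q : ℕ) {f₁ f₂ : ℝ} (hf₁ : f₁ ≠ 0) (h : f₁ = f₂) :
    kappaPM q f₁ f₂ = 1 := by
  unfold kappaPM; rw [h, div_self (h ▸ hf₁), one_pow]

/-! ## The KKT sign law at a kink -/

/-- KKT in log units. Stationarity of `J` along a displacement, `w₁ d₁ + w₂ d₂ = 0`, with `dᵢ = fᵢ ℓᵢ`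
(`ℓᵢ` = logarithmic rate of limb `i`), gives `ℓ₂ = -κ ℓ₁`, `κ = (w₁ f₁)/(w₂ f₂)`. -/
theorem kkt_logRate {w₁ w₂ f₁ f₂ ℓ₁ ℓ₂ : ℝ} (hw₂ : 0 < w₂) (hf₂ : 0 < f₂)
    (hkkt : w₁ * (f₁ * ℓ₁) + w₂ * (f₂ * ℓ₂) = 0) :
    ℓ₂ = -(w₁ * f₁ / (w₂ * f₂)) * ℓ₁ := by
  have hne : w₂ * f₂ ≠ 0 := by positivity
  field_simp
  linarith

/-- The budget's log rate: `ℓ₁ + ℓ₂ = (1 - κ) ℓ₁`. -/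
theorem dlogBudget_eq {κ ℓ₁ ℓ₂ : ℝ} (h : ℓ₂ = -κ * ℓ₁) : ℓ₁ + ℓ₂ = (1 - κ) * ℓ₁ := by
  rw [h]; ring

/-- THE SIGN LAW (P-G13-2 (a)). At a kink whose level-one limb is the smaller one (`1 < κ`), every
displacement with a first-order BUDGET GAIN spends level one and buys level two. -/
theorem budget_gain_spends_smaller_limb {κ ℓ₁ ℓ₂ : ℝ} (hκ : 1 < κ) (h : ℓ₂ = -κ * ℓ₁)
    (hgain : 0 < ℓ₁ + ℓ₂) : ℓ₁ < 0 ∧ 0 < ℓ₂ := by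
  have hsum : ℓ₁ + ℓ₂ = (1 - κ) * ℓ₁ := dlogBudget_eq h
  have hneg : ℓ₁ < 0 := by
    by_contra hcon
    have hcon' : 0 ≤ ℓ₁ := not_lt.mp hcon
    have : (1 - κ) * ℓ₁ ≤ 0 := by nlinarith
    linarith
  refine ⟨hneg, ?_⟩
  rw [h]; nlinarith

/-- Conversely: re-tuning level one (`0 < ℓ₁`) at such a kink LOSES budget to first order. -/
theorem level_one_gain_lowers_budget {κ ℓ₁ ℓ₂ : ℝ} (hκ : 1 < κ) (h : ℓ₂ = -κ * ℓ₁)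
    (hup : 0 < ℓ₁) : ℓ₁ + ℓ₂ < 0 := by
  rw [dlogBudget_eq h]; nlinarith

/-- At an exactly balanced kink (`κ = 1`) the budget is stationary as well. -/
theorem budget_stationary_of_balanced {ℓ₁ ℓ₂ : ℝ} (h : ℓ₂ = -1 * ℓ₁) : ℓ₁ + ℓ₂ = 0 := by
  rw [h]; ring

/-- The sign law assembled from the weights: limbs `0 < f₁ < f₂`, power mean of order `-q` (`q ≥ 1`),
KKT along the displacement, first-order budget gain ⟹ level one falls, level two rises. -/
theorem budget_gain_spends_level_one (q : ℕ) (hq : q ≠ 0) {f₁ f₂ J ℓ₁ ℓ₂ : ℝ}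
    (hf₁ : 0 < f₁) (h12 : f₁ < f₂) (hJ : 0 < J)
    (hkkt : pmWeight q f₁ J * (f₁ * ℓ₁) + pmWeight q f₂ J * (f₂ * ℓ₂) = 0)
    (hgain : 0 < ℓ₁ + ℓ₂) : ℓ₁ < 0 ∧ 0 < ℓ₂ := by
  have hf₂ : 0 < f₂ := lt_trans hf₁ h12
  have hw₂ : 0 < pmWeight q f₂ J := pmWeight_pos q hf₂ hJ
  have hrate := kkt_logRate hw₂ hf₂ hkkt
  have hk : pmWeight q f₁ J * f₁ / (pmWeight q f₂ J * f₂) = kappaPM q f₁ f₂ := kappa_pm q hf₁ hf₂ hJ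
  rw [hk] at hrate
  exact budget_gain_spends_smaller_limb (one_lt_kappa_pm hq hf₁ h12) hrate hgain

/-! ## Numeric anchors at row (d) (`R3D-96-band34-relay-p12-nu0.0025-T3`, result.json 3cb83a27…) -/

/-- Row (d)'s smooth limbs are equal to 2.5 % in the objective's currency. -/
theorem rowD_limbs : (0.0251 : ℝ) < 0.57195 / 0.55794 - 1 ∧ (0.57195 : ℝ) / 0.55794 - 1 < 0.0252 := by
  constructor <;> norm_num

/-- Row (d)'s marginal rate `κ = (f₂/f₁)^12 ∈ (1.346, 1.347)`. -/
theorem rowD_kappa : (1.346 : ℝ) < kappaPM 12 0.55794 0.57195 ∧ kappaPM 12 0.55794 0.57195 < 1.347 := by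
  unfold kappaPM; constructor <;> norm_num

/-- Row (d)'s weight ratio `w₁/w₂ = (f₂/f₁)^13 ∈ (1.380, 1.381)` (the anti-parallel gradients' factor). -/
theorem rowD_weightRatio : (1.380 : ℝ) < (0.57195 / 0.55794) ^ 13 ∧ ((0.57195 : ℝ) / 0.55794) ^ 13 < 1.381 := by
  constructor <;> norm_num

/-- Row (d)'s budget rate `d ln Q_s / d ln f₁ = 1 - κ ∈ (-0.347, -0.346)`. -/
theorem rowD_budgetRate :
    (-0.347 : ℝ) < 1 - kappaPM 12 0.55794 0.57195 ∧ 1 - kappaPM 12 0.55794 0.57195 < -0.346 := by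
  unfold kappaPM; constructor <;> norm_num

/-- Row (d)'s budget in the smooth currency `Q_s = λ² f₁ f₂ = 4 · 0.55794 · 0.57195 ∈ (1.2764, 1.2765)`. -/
theorem rowD_Qs : (1.2764 : ℝ) < 2 ^ 2 * 0.55794 * 0.57195 ∧ (2 : ℝ) ^ 2 * 0.55794 * 0.57195 < 1.2765 := by
  constructor <;> norm_num

/-- At row (d) the sign law applies: `κ > 1`. -/
theorem rowD_sign_law {ℓ₁ ℓ₂ : ℝ} (h : ℓ₂ = -(kappaPM 12 0.55794 0.57195) * ℓ₁) (hgain : 0 < ℓ₁ + ℓ₂) :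
    ℓ₁ < 0 ∧ 0 < ℓ₂ :=
  budget_gain_spends_smaller_limb (by linarith [rowD_kappa.1]) h hgain

/-! ## The envelope theorem: design slack is second order -/

/-- If a frozen design's value `W` never exceeds the value function `V` and attains it at `ν₀`, the design
slack `V - W` has a local (indeed global) minimum at `ν₀`. -/
theorem slack_isLocalMin (V W : ℝ → ℝ) (ν₀ : ℝ) (hle : ∀ ν, W ν ≤ V ν) (h0 : W ν₀ = V ν₀) :
    IsLocalMin (fun ν => V ν - W ν) ν₀ :=
  Filter.Eventually.of_forall fun ν => by
    show V ν₀ - W ν₀ ≤ V ν - W ν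
    linarith [hle ν]

/-- ENVELOPE THEOREM, first-order content (P-G13-1): the design slack is stationary at `ν₀` —
re-optimising the design at a nearby `ν` recovers only second-order gain over the frozen optimiser.
(`deriv` is Mathlib's: the statement holds with no differentiability hypothesis.) -/
theorem slack_deriv_eq_zero (V W : ℝ → ℝ) (ν₀ : ℝ) (hle : ∀ ν, W ν ≤ V ν) (h0 : W ν₀ = V ν₀) :
    deriv (fun ν => V ν - W ν) ν₀ = 0 :=
  (slack_isLocalMin V W ν₀ hle h0).deriv_eq_zero

/-- The lens's quadratic slack model on the ladder coordinate `x = (ν₀ - ν)/ν₀ ∈ [0, 1]`: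
residual slack `s₀` at `ν₀` plus the second-order term calibrated so that `x = 1` (Euler) gives `S_E`. -/
noncomputable def slackModel (s₀ SE x : ℝ) : ℝ := s₀ + (SE - s₀) * x ^ 2

/-- Predicted stage-1 growth at `ν₀/3`: `1 + s₀ + (4/9)(S_E - s₀)`. -/
noncomputable def envelopeGrowth (s₀ SE : ℝ) : ℝ := 1 + s₀ + (4 / 9) * (SE - s₀)

/-- The slack model returns the residual slack `s₀` at the design point `x = 0`. -/
theorem slackModel_zero (s₀ SE : ℝ) : slackModel s₀ SE 0 = s₀ := by unfold slackModel; ring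
/-- The slack model returns the Euler calibration `S_E` at `x = 1`. -/
theorem slackModel_one (s₀ SE : ℝ) : slackModel s₀ SE 1 = SE := by unfold slackModel; ring

/-- `ν = ν₀/3` is `x = 2/3`, whence the factor `4/9`. -/
theorem slackModel_two_thirds (s₀ SE : ℝ) :
    1 + slackModel s₀ SE (2 / 3) = envelopeGrowth s₀ SE := by
  unfold slackModel envelopeGrowth; ring

/-- The model is monotone along the ladder when the Euler slack dominates the residual one. -/
theorem slackModel_mono {s₀ SE x y : ℝ} (hs : s₀ ≤ SE) (hx : 0 ≤ x) (hxy : x ≤ y) :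
    slackModel s₀ SE x ≤ slackModel s₀ SE y := by
  unfold slackModel
  have : x ^ 2 ≤ y ^ 2 := by nlinarith
  nlinarith

/-- P-G13-1 (a): the `ν₀/3` growth never exceeds the Euler calibration `1 + S_E` iff `s₀ ≤ S_E`. -/
theorem envelopeGrowth_le_iff (s₀ SE : ℝ) : envelopeGrowth s₀ SE ≤ 1 + SE ↔ s₀ ≤ SE := by
  unfold envelopeGrowth; constructor <;> intro h <;> nlinarith

/-- `envelopeGrowth` is increasing in the residual slack `s₀` (coefficient `5/9`). -/
theorem envelopeGrowth_eq (s₀ SE : ℝ) : envelopeGrowth s₀ SE = 1 + (5 / 9) * s₀ + (4 / 9) * SE := by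
  unfold envelopeGrowth; ring

/-- The predicted stage-1 growth is monotone in the residual slack `s₀`. -/
theorem envelopeGrowth_mono_s₀ {s₀ s₀' SE : ℝ} (h : s₀ ≤ s₀') :
    envelopeGrowth s₀ SE ≤ envelopeGrowth s₀' SE := by
  rw [envelopeGrowth_eq, envelopeGrowth_eq]; linarith

/-- P-G13-1 (b): with `S_E = 0.1003` (A6) and `s₀ ∈ [0, 0.06]` the predicted stage-1 growth lies in
`[1.044, 1.078]`, inside the registered window `[1.035, 1.085]`. -/
theorem envelopeGrowth_window {s₀ : ℝ} (h0 : 0 ≤ s₀) (h1 : s₀ ≤ 0.06) :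
    (1.044 : ℝ) ≤ envelopeGrowth s₀ 0.1003 ∧ envelopeGrowth s₀ 0.1003 ≤ 1.078 := by
  rw [envelopeGrowth_eq]; constructor <;> nlinarith

/-- P-G13-1 (b): for `s₀ ∈ [0, 0.06]` and `S_E = 0.1003` the predicted growth lies in the registered window `[1.035, 1.085]`. -/
theorem envelopeGrowth_in_registered_window {s₀ : ℝ} (h0 : 0 ≤ s₀) (h1 : s₀ ≤ 0.06) :
    (1.035 : ℝ) ≤ envelopeGrowth s₀ 0.1003 ∧ envelopeGrowth s₀ 0.1003 ≤ 1.085 := by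
  obtain ⟨ha, hb⟩ := envelopeGrowth_window h0 h1
  exact ⟨by linarith, by linarith⟩

/-- The Euler calibration itself: `envelopeGrowth s₀ S_E` at `s₀ = S_E` is `1 + S_E` (no ladder gain left). -/
theorem envelopeGrowth_self (SE : ℝ) : envelopeGrowth SE SE = 1 + SE := by unfold envelopeGrowth; ring

end Summit.NavierStokesRegularity.FluidComputer.KinkBudget
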